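import Mathlib
import Summits.KontsevichZagierPeriods.Zeta5Search.BrickLambdaDigit
import Summits.KontsevichZagierPeriods.Zeta5Search.BrickLevelReduction
import Summits.KontsevichZagierPeriods.Zeta5Search.BrickHoleWeight

/-!
# BrickCellReflectionTwo — the well-poised REFLECTION of the centre-free brick cells, `c̃_{n−K,s}(n) = (−1)^{A−s}c̃_{K,s}(n)`
(`A` even, every `B`), the PAIRING `k ↔ M − k` of an exactly antisymmetric weight against reflection-odd cells, and the
reflection-equivariance of the chain's block / hole weights at the prime `2` (cell `pub-zeta5`, seat ct-1 g44)

HONEST FRAMING: systematic search; no irrationality claim unless certified.  Exact identities between the partial-fraction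
cells of the centre-free brick kernel `R_n(t) = n!^{A−2B}(t−n)_n^B(t+n+1)_n^B/(t)_{n+1}^A` (`BrickLaurent.cell A B 0`) and
between the block / hole weights of `BrickLevelReduction` / `BrickHoleWeight` at `p = 2`; nothing about `ζ(5)`/`ζ(3)`, no
`γ` / record statement; records in print UNMOVED; NOTHING IS DISCHARGED (net named-fact debt 0).  Theorems only (0 `def`).

WHY (ct-1 g44's item «the spare factor 2 is the pairing»): ct-1 g43's `BrickPropositionHTwo.propositionH_two` bounds the
2-admissibly weighted cell sums by `exp(−ℓ)`; its sequel `BrickPropositionHTwoSharp` gains one more factor `2` for odd `s`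
by pairing `k` with `M − k`.  The pairing needs, for GENERAL `(A,B)` with `A` even:

* `eval_kerNum_zero_reflect`, `eval_kerDenErase_reflect` — `kerNum(−n−t) = kerNum(t)` (ε = 0) and
  `kerDenErase_{n−K}(−n−t) = kerDenErase_K(t)`; hence **`laurentSeries_zero_reflect`**: `F_{n−K}(T) = F_K(−T)`
  (`PowerSeries.rescale (−1)`; the route of zi-eng's `BrickLaurent.laurentSeries_frobenius`), `laurent_zero_reflect`
  (`laurent(n, n−K, d) = (−1)^d·laurent(n, K, d)`) and **`cell_zero_reflect`**: `c̃_{n−K,s}(n) = (−1)^{A−s}·c̃_{K,s}(n)` —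
  in the tree before only at `a = 6` (`Zudilin2002IntegralityDerivative.cell_zero_reflect`, via `BallRivoal.pf_R_symm`);
* `sum_pair_of_reflect`, `sum_antisymm_pair` — if `W = W′ + W″` with `W″(K) = −W′(N−K)` against values `Y(N−K) = −Y(K)`
  then `Σ W·Y = 2·Σ W′·Y`; in particular `Σ_k g(k)X_k = 2·Σ_{2k<M} g(k)X_k` for `g` exactly antisymmetric, `X` reflection-odd;
* `blockWeight_congr/_sub/_neg`, `holeWeight_congr/_sub/_neg` and the REFLECTION-EQUIVARIANCE at `p = 2` for an ARBITRARY
  weight `h`: `blockWeight A B 0 2 1 N h (N−K) = blockWeight A B 0 2 1 N (k ↦ h(2N+1−k)) K` (odd row),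
  `blockWeight A B 0 2 0 (N+1) h (N+1−K) = blockWeight A B 0 2 0 (N+1) (k ↦ h(2N+2−k)) K`,
  `holeWeight A B 0 2 0 N h (N−K) = holeWeight A B 0 2 0 N (k ↦ h(2N+2−k)) K` (even row) — the multipliers being
  reflection-invariant (`BrickLambdaDigit.cTop_zero_reflect`).
-/

namespace Summit.KontsevichZagierPeriods.Zeta5Search.BrickCellReflectionTwo

open Finset Nat Polynomial
open Summit.KontsevichZagierPeriods.Zeta5Search.BrickTopCoefficient (cTop)
open Summit.KontsevichZagierPeriods.Zeta5Search.BrickLaurent (kerNum kerDenErase eval_kerNum eval_kerDenErase expandAt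
  laurentSeries laurent cell coe_comp_C_mul_X rescale_inv constantCoeff_coe_taylor eval_kerDenErase_neg_ne_zero)
open Summit.KontsevichZagierPeriods.Zeta5Search.BrickLambdaDigit (cTop_zero_reflect)
open Summit.KontsevichZagierPeriods.Zeta5Search.BrickLevelReduction (blockWeight)
open Summit.KontsevichZagierPeriods.Zeta5Search.BrickHoleWeight (holeWeight)

noncomputable section

/-! ## The reflection `t ↦ −n − t` of the centre-free kernel -/

/-- `kerNum(−n−t) = kerNum(t)` for the centre-free numerator `n!^{A−2B}(∏_{m=1}^{n}(t−m))^B(∏_{m=1}^{n}(t+n+m))^B`: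
the two products are exchanged, each with the sign `(−1)^n`. -/
theorem eval_kerNum_zero_reflect (A B n : ℕ) (t : ℚ) :
    (kerNum A B 0 n).eval (-(n : ℚ) - t) = (kerNum A B 0 n).eval t := by
  rw [eval_kerNum, eval_kerNum, pow_zero, pow_zero]
  have h1 : ∏ m ∈ Icc 1 n, (-(n : ℚ) - t - m) = (-1) ^ n * ∏ m ∈ Icc 1 n, (t + n + m) := by
    rw [show (∏ m ∈ Icc 1 n, (-(n : ℚ) - t - m)) = ∏ m ∈ Icc 1 n, ((-1) * (t + n + m)) from
      prod_congr rfl fun m _ => by ring, prod_mul_distrib, prod_const, Nat.card_Icc, Nat.add_sub_cancel]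
  have h2 : ∏ m ∈ Icc 1 n, (-(n : ℚ) - t + n + m) = (-1) ^ n * ∏ m ∈ Icc 1 n, (t - m) := by
    rw [show (∏ m ∈ Icc 1 n, (-(n : ℚ) - t + n + m)) = ∏ m ∈ Icc 1 n, ((-1) * (t - m)) from
      prod_congr rfl fun m _ => by ring, prod_mul_distrib, prod_const, Nat.card_Icc, Nat.add_sub_cancel]
  have hsq : ((-1 : ℚ) ^ n) ^ B * ((-1 : ℚ) ^ n) ^ B = 1 := by
    rw [← mul_pow, ← mul_pow, neg_one_mul, neg_neg, one_pow, one_pow]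
  rw [h1, h2, mul_pow, mul_pow]
  linear_combination ((n ! : ℚ) ^ (A - 2 * B) * (∏ m ∈ Icc 1 n, (t - (m : ℚ))) ^ B *
    (∏ m ∈ Icc 1 n, (t + n + (m : ℚ))) ^ B) * hsq

/-- `kerDenErase_{n−K}(−n−t) = kerDenErase_K(t)` for `A` even: `∏_{m≤n, m≠n−K}(−n−t+m) = (−1)^n∏_{m≤n, m≠K}(t+m)`
(reindex `m ↦ n − m`), and `((−1)^n)^A = 1`. -/
theorem eval_kerDenErase_reflect {A : ℕ} (hA : Even A) {n K : ℕ} (hK : K ≤ n) (t : ℚ) :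
    (kerDenErase A n (n - K)).eval (-(n : ℚ) - t) = (kerDenErase A n K).eval t := by
  rw [eval_kerDenErase, eval_kerDenErase]
  have hre : ∏ m ∈ (range (n + 1)).erase (n - K), (-(n : ℚ) - t + m) =
      ∏ m ∈ (range (n + 1)).erase K, (-(n : ℚ) - t + ((n - m : ℕ) : ℚ)) := by
    refine prod_nbij' (fun m => n - m) (fun m => n - m) (fun a ha => ?_) (fun a ha => ?_) (fun a ha => ?_)
      (fun a ha => ?_) (fun a ha => ?_)
    · simp only [mem_erase, mem_range, ne_eq] at ha ⊢; omega
    · simp only [mem_erase, mem_range, ne_eq] at ha ⊢; omega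
    · simp only [mem_erase, mem_range, ne_eq] at ha; omega
    · simp only [mem_erase, mem_range, ne_eq] at ha; omega
    · simp only [mem_erase, mem_range, ne_eq] at ha
      rw [show n - (n - a) = a by omega]
  have h : ∏ m ∈ (range (n + 1)).erase (n - K), (-(n : ℚ) - t + m) = (-1) ^ n * ∏ m ∈ (range (n + 1)).erase K, (t + m) := by
    rw [hre, show (∏ m ∈ (range (n + 1)).erase K, (-(n : ℚ) - t + ((n - m : ℕ) : ℚ))) =
      ∏ m ∈ (range (n + 1)).erase K, ((-1) * (t + m)) from prod_congr rfl fun m hm => by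
        have hm' : m ≤ n := by have := mem_range.1 (mem_of_mem_erase hm); omega
        push_cast [Nat.cast_sub hm']; ring,
      prod_mul_distrib, prod_const, card_erase_of_mem (by simp; omega), card_range, Nat.add_sub_cancel]
  rw [h, mul_pow, ← pow_mul, (hA.mul_left n).neg_one_pow, one_mul]

/-- **The Laurent series at reflected poles**: `F_{n−K}(T) = F_K(−T)` for the centre-free kernel, `A` even, `K ≤ n`
(`F_K(T) = T^A·R_n(−K+T)`), as `laurentSeries A B 0 n (n−K) = rescale (−1) (laurentSeries A B 0 n K)`. -/
theorem laurentSeries_zero_reflect {A : ℕ} (hA : Even A) (B : ℕ) {n K : ℕ} (hK : K ≤ n) :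
    laurentSeries A B 0 n (n - K) = PowerSeries.rescale (-1 : ℚ) (laurentSeries A B 0 n K) := by
  have hN : taylor (-((n - K : ℕ) : ℚ)) (kerNum A B 0 n) = (taylor (-(K : ℚ)) (kerNum A B 0 n)).comp (C (-1 : ℚ) * X) := by
    apply Polynomial.funext
    intro T
    rw [taylor_eval, eval_comp, eval_mul, eval_C, eval_X, taylor_eval, Nat.cast_sub hK,
      show T + -((n : ℚ) - K) = -(n : ℚ) - (-1 * T + -K) by ring, eval_kerNum_zero_reflect]
  have hD : taylor (-((n - K : ℕ) : ℚ)) (kerDenErase A n (n - K)) =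
      (taylor (-(K : ℚ)) (kerDenErase A n K)).comp (C (-1 : ℚ) * X) := by
    apply Polynomial.funext
    intro T
    rw [taylor_eval, eval_comp, eval_mul, eval_C, eval_X, taylor_eval, Nat.cast_sub hK,
      show T + -((n : ℚ) - K) = -(n : ℚ) - (-1 * T + -K) by ring, eval_kerDenErase_reflect hA hK]
  rw [laurentSeries, laurentSeries, expandAt, expandAt, hN, hD, coe_comp_C_mul_X, coe_comp_C_mul_X, map_mul,
    rescale_inv _ (by rw [constantCoeff_coe_taylor]; exact eval_kerDenErase_neg_ne_zero A n K)]

/-- **Reflection of the Laurent coefficients**: `laurent(n, n−K, d) = (−1)^d·laurent(n, K, d)` (centre-free, `A` even). -/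
theorem laurent_zero_reflect {A : ℕ} (hA : Even A) (B : ℕ) {n K : ℕ} (hK : K ≤ n) (d : ℕ) :
    laurent A B 0 n (n - K) d = (-1) ^ d * laurent A B 0 n K d := by
  rw [laurent, laurent, laurentSeries_zero_reflect hA B hK, PowerSeries.coeff_rescale]

/-- **Reflection of the centre-free cells**: `c̃_{n−K,s}(n) = (−1)^{A−s}·c̃_{K,s}(n)` for `A` even, every `B`, `K ≤ n`
and every `s` (truncated subtraction: for `s > A` both sides are the top coefficient). -/
theorem cell_zero_reflect {A : ℕ} (hA : Even A) (B : ℕ) {n K : ℕ} (hK : K ≤ n) (s : ℕ) :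
    cell A B 0 n (n - K) s = (-1) ^ (A - s) * cell A B 0 n K s := by
  rw [cell, cell, laurent_zero_reflect hA B hK]

/-- Odd orders `s ≤ A` are reflection-ODD: `c̃_{n−K,s}(n) = −c̃_{K,s}(n)`. -/
theorem cell_zero_reflect_odd {A : ℕ} (hA : Even A) (B : ℕ) {n K : ℕ} (hK : K ≤ n) {s : ℕ} (hs : Odd s)
    (hsA : s ≤ A) : cell A B 0 n (n - K) s = -cell A B 0 n K s := by
  rw [cell_zero_reflect hA B hK, (Nat.Even.sub_odd hsA hA hs).neg_one_pow, neg_one_mul]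

/-- Even orders (and `s > A`) are reflection-EVEN: `c̃_{n−K,s}(n) = c̃_{K,s}(n)` whenever `A − s` is even. -/
theorem cell_zero_reflect_even {A : ℕ} (B : ℕ) {n K : ℕ} (hK : K ≤ n) {s : ℕ} (hA : Even A) (hs : Even (A - s)) :
    cell A B 0 n (n - K) s = cell A B 0 n K s := by
  rw [cell_zero_reflect hA B hK, hs.neg_one_pow, one_mul]

/-! ## Pairing `k ↔ M − k` -/

/-- **Pairing lemma**: if `W = W′ + W″` on `[0, N]` with `W″(K) = −W′(N−K)`, against values with `Y(N−K) = −Y(K)`, then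
`Σ_{K≤N} W(K)Y(K) = 2·Σ_{K≤N} W′(K)Y(K)`. -/
theorem sum_pair_of_reflect {N : ℕ} {W W' W'' Y : ℕ → ℚ} (hW : ∀ K, K ≤ N → W K = W' K + W'' K)
    (hW'' : ∀ K, K ≤ N → W'' K = -W' (N - K)) (hY : ∀ K, K ≤ N → Y (N - K) = -Y K) :
    ∑ K ∈ range (N + 1), W K * Y K = 2 * ∑ K ∈ range (N + 1), W' K * Y K := by
  have h1 : ∑ K ∈ range (N + 1), W K * Y K =
      ∑ K ∈ range (N + 1), W' K * Y K + ∑ K ∈ range (N + 1), W'' K * Y K := by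
    rw [← sum_add_distrib]
    exact sum_congr rfl fun K hK => by rw [hW K (by have := mem_range.1 hK; omega)]; ring
  have h2 : ∑ K ∈ range (N + 1), W'' K * Y K = ∑ K ∈ range (N + 1), W' K * Y K := by
    rw [← sum_range_reflect (fun K => W' K * Y K) (N + 1)]
    refine sum_congr rfl fun K hK => ?_
    have hKN : K ≤ N := by have := mem_range.1 hK; omega
    have hY' : Y K = -Y (N - K) := by
      have h := hY (N - K) (Nat.sub_le N K); rw [show N - (N - K) = K by omega] at h; exact h
    rw [show N + 1 - 1 - K = N - K by omega, hW'' K hKN, hY']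
    ring
  rw [h1, h2, two_mul]

/-- **Antisymmetric weight against reflection-odd values**: for `g` with `g(M−k) + g(k) = 0` on `[0, M]` and `X(M−k) = −X(k)`:
`Σ_{k≤M} g(k)X(k) = 2·Σ_{k≤M, 2k<M} g(k)X(k)` (the middle term, if any, has `g(M/2) = 0`). -/
theorem sum_antisymm_pair {M : ℕ} {g X : ℕ → ℚ} (hgS : ∀ k, k ≤ M → g (M - k) + g k = 0)
    (hX : ∀ k, k ≤ M → X (M - k) = -X k) :
    ∑ k ∈ range (M + 1), g k * X k = 2 * ∑ k ∈ range (M + 1), (if 2 * k < M then g k else 0) * X k := by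
  refine sum_pair_of_reflect (W'' := fun k => if 2 * k < M then 0 else g k) (fun k _ => ?_) (fun k hk => ?_) hX
  · split_ifs <;> simp
  · show (if 2 * k < M then 0 else g k) = -(if 2 * (M - k) < M then g (M - k) else 0)
    have hg : g k = -g (M - k) := by linarith [hgS k hk]
    by_cases h1 : 2 * k < M
    · rw [if_pos h1, if_neg (by omega), neg_zero]
    · rw [if_neg h1]
      by_cases h2 : 2 * (M - k) < M
      · rw [if_pos h2, hg]
      · -- the middle term `2k = M`: `g(k) = 0`
        rw [if_neg h2, neg_zero]
        have hkM : M - k = k := by omega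
        rw [hkM] at hg; linarith

/-! ## Block and hole weights: congruence, linearity, reflection-equivariance at `p = 2` -/

/-- The block weight only reads the weight on the row: `h₁ = h₂` on `[0, n₀ + Np]` ⇒ equal block weights at `K ≤ N`. -/
theorem blockWeight_congr {A B ε p n₀ N : ℕ} {h₁ h₂ : ℕ → ℚ} (hh : ∀ k, k ≤ n₀ + N * p → h₁ k = h₂ k) {K : ℕ}
    (hK : K ≤ N) : blockWeight A B ε p n₀ N h₁ K = blockWeight A B ε p n₀ N h₂ K := by
  unfold blockWeight
  exact sum_congr rfl fun k₀ hk₀ => by rw [hh _ (by have := mem_range.1 hk₀; nlinarith)]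

/-- Linearity of the block weight: `blockWeight(h₁ − h₂) = blockWeight h₁ − blockWeight h₂`. -/
theorem blockWeight_sub (A B ε p n₀ N : ℕ) (h₁ h₂ : ℕ → ℚ) (K : ℕ) :
    blockWeight A B ε p n₀ N (fun k => h₁ k - h₂ k) K = blockWeight A B ε p n₀ N h₁ K - blockWeight A B ε p n₀ N h₂ K := by
  unfold blockWeight
  rw [← sum_sub_distrib]
  exact sum_congr rfl fun k₀ _ => by ring

/-- `blockWeight(−h) = −blockWeight h`. -/
theorem blockWeight_neg (A B ε p n₀ N : ℕ) (h : ℕ → ℚ) (K : ℕ) :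
    blockWeight A B ε p n₀ N (fun k => -h k) K = -blockWeight A B ε p n₀ N h K := by
  unfold blockWeight
  rw [← sum_neg_distrib]
  exact sum_congr rfl fun k₀ _ => by ring

/-- The hole weight only reads the weight on `[0, n₀ + (m+1)p]`. -/
theorem holeWeight_congr {A B ε p n₀ m : ℕ} {h₁ h₂ : ℕ → ℚ} (hh : ∀ k, k ≤ n₀ + (m + 1) * p → h₁ k = h₂ k) {K : ℕ}
    (hK : K ≤ m) : holeWeight A B ε p n₀ m h₁ K = holeWeight A B ε p n₀ m h₂ K := by
  unfold holeWeight
  exact sum_congr rfl fun k₀ hk₀ => by rw [hh _ (by have := (mem_Ico.1 hk₀).2; nlinarith)]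

/-- Linearity of the hole weight. -/
theorem holeWeight_sub (A B ε p n₀ m : ℕ) (h₁ h₂ : ℕ → ℚ) (K : ℕ) :
    holeWeight A B ε p n₀ m (fun k => h₁ k - h₂ k) K = holeWeight A B ε p n₀ m h₁ K - holeWeight A B ε p n₀ m h₂ K := by
  unfold holeWeight
  rw [← sum_sub_distrib]
  exact sum_congr rfl fun k₀ _ => by ring

/-- `holeWeight(−h) = −holeWeight h`. -/
theorem holeWeight_neg (A B ε p n₀ m : ℕ) (h : ℕ → ℚ) (K : ℕ) :
    holeWeight A B ε p n₀ m (fun k => -h k) K = -holeWeight A B ε p n₀ m h K := by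
  unfold holeWeight
  rw [← sum_neg_distrib]
  exact sum_congr rfl fun k₀ _ => by ring

/-- **Reflection-equivariance of the block weight on an odd row `2N+1`** (centre-free kernel, `A` even, ANY weight `h`):
`W_h(N−K) = W_{h∘(2N+1−·)}(K)` — the even pole `2(N−K) = (2N+1) − (2K+1)` carries the multiplier of the odd pole `2K+1`
and vice versa (`cTop_zero_reflect` on the rows `2N+1` and `N`). -/
theorem blockWeight_two_odd_reflect_gen {A : ℕ} (hA : Even A) (B : ℕ) {N : ℕ} (h : ℕ → ℚ) {K : ℕ} (hK : K ≤ N) :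
    blockWeight A B 0 2 1 N h (N - K) = blockWeight A B 0 2 1 N (fun k => h (2 * N + 1 - k)) K := by
  unfold blockWeight
  simp only [sum_range_succ, sum_range_zero, zero_add]
  have h1 : cTop A B 0 (1 + N * 2) ((N - K) * 2) = cTop A B 0 (1 + N * 2) (1 + K * 2) := by
    rw [← cTop_zero_reflect hA B (by omega : 1 + K * 2 ≤ 1 + N * 2)]; congr 1; omega
  have h2 : cTop A B 0 (1 + N * 2) (1 + (N - K) * 2) = cTop A B 0 (1 + N * 2) (K * 2) := by
    rw [← cTop_zero_reflect hA B (by omega : K * 2 ≤ 1 + N * 2)]; congr 1; omega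
  have h3 : cTop A B 0 N (N - K) = cTop A B 0 N K := cTop_zero_reflect hA B hK
  rw [h1, h2, h3, show 2 * N + 1 - K * 2 = 1 + (N - K) * 2 by omega, show 2 * N + 1 - (1 + K * 2) = (N - K) * 2 by omega]
  ring

/-- **Reflection-equivariance of the block weight on an even row `2N+2`** (row `N+1`, `n₀ = 0`; ANY weight `h`):
`W_h(N+1−K) = W_{h∘(2N+2−·)}(K)`. -/
theorem blockWeight_two_even_reflect_gen {A : ℕ} (hA : Even A) (B : ℕ) {N : ℕ} (h : ℕ → ℚ) {K : ℕ} (hK : K ≤ N + 1) :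
    blockWeight A B 0 2 0 (N + 1) h (N + 1 - K) = blockWeight A B 0 2 0 (N + 1) (fun k => h (2 * N + 2 - k)) K := by
  unfold blockWeight
  simp only [sum_range_one, zero_add]
  have h1 : cTop A B 0 ((N + 1) * 2) ((N + 1 - K) * 2) = cTop A B 0 ((N + 1) * 2) (K * 2) := by
    rw [← cTop_zero_reflect hA B (by omega : K * 2 ≤ (N + 1) * 2)]; congr 1; omega
  have h3 : cTop A B 0 (N + 1) (N + 1 - K) = cTop A B 0 (N + 1) K := cTop_zero_reflect hA B hK
  rw [h1, h3, show 2 * N + 2 - K * 2 = (N + 1 - K) * 2 by omega]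

/-- **Reflection-equivariance of the hole weight on an even row `2N+2`** (holes `2K+1 ↔ 2(N−K)+1`, row `N`; ANY `h`):
`G_h(N−K) = G_{h∘(2N+2−·)}(K)`. -/
theorem holeWeight_two_reflect_gen {A : ℕ} (hA : Even A) (B : ℕ) {N : ℕ} (h : ℕ → ℚ) {K : ℕ} (hK : K ≤ N) :
    holeWeight A B 0 2 0 N h (N - K) = holeWeight A B 0 2 0 N (fun k => h (2 * N + 2 - k)) K := by
  unfold holeWeight
  simp only [show Ico 1 2 = ({1} : Finset ℕ) by rfl, sum_singleton, zero_add]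
  have h1 : cTop A B 0 ((N + 1) * 2) (1 + (N - K) * 2) = cTop A B 0 ((N + 1) * 2) (1 + K * 2) := by
    rw [← cTop_zero_reflect hA B (by omega : 1 + K * 2 ≤ (N + 1) * 2)]; congr 1; omega
  have h3 : cTop A B 0 N (N - K) = cTop A B 0 N K := cTop_zero_reflect hA B hK
  rw [h1, h3, show 2 * N + 2 - (1 + K * 2) = 1 + (N - K) * 2 by omega]

end

end Summit.KontsevichZagierPeriods.Zeta5Search.BrickCellReflectionTwo
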